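import Literature.Topology.FourManifolds.CircleNbhdTrace
import Literature.Topology.FourManifolds.TwistedSurgeryProjectivePlane
import Literature.Topology.FourManifolds.FramedSpheresEvenFormHomology
import Literature.Topology.FourManifolds.StabilisedSphereFilling
import Literature.Topology.FourManifolds.LatticeDualityAnnihilator
import Literature.Topology.FourManifolds.LatticeFormsLagrangian
import Literature.Topology.FourManifolds.BordismFourSignatureZero
import HarnessLib

/-!
# The twisted filling of `S² ×~ S²`: an odd closed 4-manifold bounding a simply connected `V⁵`
# with a computed Lagrangian (Wall 1964 §2; Kirby 1989 Ch. VIII p. 50, Ch. X p. 55)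

Topic `Literature/Topology/FourManifolds` (fact seat of
`Literature.Topology.FourManifolds.isHCobordant_of_equivalent_intersectionForm`, Wall's theorem
on h-cobordism, C. T. C. Wall, *On simply-connected 4-manifolds*, J. London Math. Soc. 39 (1964),
Thm. 2 and §2).  Wall's trick for ODD forms (sequel) needs an odd CORE-FREE model: a simply
connected closed smooth 4-manifold `T` with intersection lattice `⟨1⟩ ⊕ ⟨-1⟩` which bounds a
simply connected compact `V⁵` onto whose `H₂` the boundary maps, together with a nonzero isotropic
class `ε ∈ H²(T)/T` detecting the classes of `T` that die in `V`.  This file builds it from the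
tree's TWISTED circle surgery: `T = χ(𝕊⁴, ν)` for the tube `ν = C.nbhd.linTwist twist` of the
standard circle of a chart `C` of `𝕊⁴` reframed by the generator of `π₁ SO(3)` (Kirby 1989,
Ch. VIII p. 50: attaching the 2-handle with the other framing gives `S² ×~ S²`), and
`V = 𝔻⁵ ∪_{𝕊⁴} ω(𝕊⁴, ν)` the trace capped by the ball.

* `T` is simply connected and ODD for every orientation (`CircleNbhdTrace.lean`,
  `isOdd_intersectionForm_of_isOpenGluingWith_twist`); the trace `E` is a simply connected
  elementary cobordism of index `2` with `H₂(T) → H₂(E)` onto.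
* **No handle homology is computed.**  Instead: (i) `H₂(E)` is free of rank `≤ 1` — the Morse
  complex of the trace has `C₂ ≅ ℤ`, `C₃ = 0` (Milnor 1965, Thm. 7.4, Cor. 3.15: the tree's
  `Milnor1965_morseHomology_free_holds`, `relativeHomology_of_morseIndex_le_two`) and
  `H₂(𝕊⁴) = 0` (`Cobordism.IsElementary.free_singularHomology_two_of_isZero`); (ii) the dying
  classes `D = ker (H₂(T) → H₂(E))` are detected by the annihilator `A = im (H²(E)/T → H²(T)/T)`
  (Kronecker biduality, `LatticeDualityAnnihilator.lean`); (iii) `A` is isotropic of half rank by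
  THOM (`Cobordism.intersectionForm_eq_of_mem_boundaryImage`, `two_mul_boundaryImageRank_eq_holds`
  for the trace from `𝕊⁴` to `T`), and of rank `≤ 1` (`H²(E)/T ≅ Hom(H₂(E), ℤ)`), so
  `b₂(T) = 2` (even, positive since `T` is odd, `≤ 2`) and `A = ℤ ε`; (iv) Wall's normal form
  (`Lagrangian.exists_normalForm`) of the Lagrangian `A` in the odd unimodular lattice `H²(T)/T`
  is a basis `(e, f)` with `e = ±ε`, `e·e = 0`, `e·f = 1`, `f·f = 1` — so `(f, e - f)` has
  Gram matrix `diag(1, -1)`.  Steps (ii)–(iv) are carried out for an ABSTRACT simply connected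
  cobordism `E` from a closed `S` with `H²(S)/T = 0` (`exists_basis_of_trace`), and the capping by
  `𝔻⁵` for an abstract cobordism from `𝕊⁴` (`exists_filling_of_cobordism_sphereFour`); the
  twisted trace is plugged in at the end (rewriting inside goals over the glued types is costly).
* `exists_twistedFilling` — the package consumed by Wall's trick for odd forms: a compact simply
  connected smooth `V⁵` with boundary datum `bV` whose boundary `T = bV.carrier` is a simply
  connected closed 4-manifold with a basis `(bT 0, bT 1)` of `H²(T)/T` of Gram matrix
  `!![0, 1; 1, 1]`, `H₂(T) → H₂(V)` onto, and the DYING LAW `⟨bT 0, y⟩ = 0 ⇒ y ↦ 0 ∈ H₂(V)`.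

Everything is proved; no named fact is introduced (D-0026).

## References

* C. T. C. Wall, *On simply-connected 4-manifolds*, J. London Math. Soc. 39 (1964) 141–149, §2
  pp. 144–146. [WallJLMS1964]
* R. C. Kirby, *The topology of 4-manifolds*, LNM 1374 (1989), Ch. VIII p. 50, Ch. X pp. 55–56.
  [Kirby1989]
* J. Milnor, *Lectures on the h-cobordism theorem* (1965), Thm. 3.12, Cor. 3.15, Thm. 7.4.
  [MilnorHCobordism1965]
* R. Thom, *Espaces fibrés en sphères et carrés de Steenrod*, Ann. Sci. ENS 69 (1952), Thm. V.7,
  Cor. V.8. [Thom1952]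
-/

noncomputable section

universe u

open scoped Manifold ContDiff Topology
open Set Function Module CategoryTheory CategoryTheory.Limits
open Literature.AlgebraicTopology.SingularHomology Literature.AlgebraicTopology.Homotopy
open LinearMap (BilinForm)

namespace Literature.Topology.FourManifolds

/-- Local notation: `𝔼 n` is the model Euclidean space `EuclideanSpace ℝ (Fin n)`. -/
local notation "𝔼 " n:arg => EuclideanSpace ℝ (Fin n)

/-- Local notation: `𝕊 n` is the unit sphere in `EuclideanSpace ℝ (Fin (n + 1))`. -/
local notation "𝕊 " n:arg => (Metric.sphere (0 : EuclideanSpace ℝ (Fin (n + 1))) 1)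

/-- Local notation: `Q⟦μ⟧` is the intersection form on `H²(·; ℤ)/T`. -/
local notation "Q⟦" μ "⟧" =>
  Literature.AlgebraicTopology.SingularHomology.intersectionForm two_add_two_eq_four μ

/-! ### The second homology of an elementary cobordism of index `2` over an end with `H₂ = 0` -/

section Morse

variable {n : ℕ} {M N : Type u} [TopologicalSpace M] [T2Space M] [SecondCountableTopology M]
  [ChartedSpace (EuclideanSpace ℝ (Fin n)) M] [IsManifold (𝓡 n) ∞ M] [CompactSpace M]
  [TopologicalSpace N] [T2Space N] [SecondCountableTopology N]
  [ChartedSpace (EuclideanSpace ℝ (Fin n)) N] [IsManifold (𝓡 n) ∞ N] [CompactSpace N]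

/-- **`H₂(W)` of an elementary cobordism of index `2` whose incoming end has `H₂ = 0` is free of
rank `≤ 1`** (Milnor 1965, Thm. 7.4 with Cor. 3.15 and the exact sequence of the pair: the Morse
complex of a nice rearrangement has `C₂ ≅ ℤ` and `C₃ = 0`, so `H₂(W, V) ↪ C₂`, and
`H₂(V) = 0` makes `H₂(W) ↪ H₂(W, V)`). [cite: MilnorHCobordism1965, Thm. 7.4 (PDF p. 48), Cor. 3.15 (PDF p. 19)] -/
theorem Cobordism.IsElementary.free_singularHomology_two_of_isZero {c : Cobordism n M N}
    (h : c.IsElementary 2) (h0 : IsZero (singularHomology ℤ ℤ (range c.inl) 2)) :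
    Module.Free ℤ (singularHomology ℤ ℤ c.W 2) ∧ Module.Finite ℤ (singularHomology ℤ ℤ c.W 2) ∧
      Module.finrank ℤ (singularHomology ℤ ℤ c.W 2) ≤ 1 := by
  classical
  obtain ⟨f, hf, ⟨z₀, hz₀, huniq⟩, hidx⟩ := h
  -- a nice rearrangement with the same critical point and index
  obtain ⟨g, hg, hcrit, hind⟩ := Cobordism.Milnor1965_finalRearrangement_holds hf
  have hcritf : criticalSet (𝓡∂ (n + 1)) f = {z₀} := by
    ext z
    simp only [mem_criticalSet, mem_singleton_iff]
    exact ⟨fun hz => huniq z hz, fun hz => hz ▸ hz₀⟩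
  have h2 : ∀ z ∈ criticalSet (𝓡∂ (n + 1)) g, morseIndex (𝓡∂ (n + 1)) g z ≤ 2 := by
    intro z hz
    have hz' : z ∈ criticalSet (𝓡∂ (n + 1)) f := hcrit ▸ hz
    rw [hind z hz', hidx z (mem_criticalSet.1 hz')]
  -- `H₂(W, V) ↪ C₂`, `C₂` free of rank `1`
  obtain ⟨-, hfree, hfin, j, hj⟩ := hg.relativeHomology_of_morseIndex_le_two h2
  haveI := hfree
  haveI := hfin
  obtain ⟨-, -, -, hrank⟩ := Cobordism.Milnor1965_morseHomology_free_holds hg 2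
  have hC₂ : Module.finrank ℤ (c.morseHomology g 2 2) = 1 := by
    rw [hrank]
    have hset : criticalSetOfIndex (𝓡∂ (n + 1)) g 2 = {z₀} := by
      ext z
      rw [mem_criticalSetOfIndex, mem_singleton_iff]
      constructor
      · rintro ⟨hz, -⟩
        have hz' : z ∈ criticalSet (𝓡∂ (n + 1)) f := hcrit ▸ (mem_criticalSet.2 hz)
        rw [hcritf] at hz'
        exact hz'
      · intro hz
        rw [hz]
        have hz' : z₀ ∈ criticalSet (𝓡∂ (n + 1)) f := mem_criticalSet.2 hz₀
        refine ⟨mem_criticalSet.1 (hcrit ▸ hz'), ?_⟩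
        rw [hind z₀ hz', hidx z₀ hz₀]
    rw [hset, ncard_singleton]
  -- `H₂(W) ↪ H₂(W, V)` since `H₂(V) = 0`
  set π := (relativeSingularHomology.ofAbsolute ℤ ℤ c.W (range c.inl) 2).hom with hπ
  have hex : Function.Exact (singularHomology.map ℤ ℤ
      (⟨Subtype.val, continuous_subtype_val⟩ : C(range c.inl, c.W)) 2).hom π :=
    (ShortComplex.ShortExact.moduleCat_exact_iff_function_exact _).1
      (relativeSingularHomology.exact_map_ofAbsolute ℤ ℤ (range c.inl) 2)
  have hπinj : Function.Injective π := by
    rw [injective_iff_map_eq_zero]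
    intro y hy
    obtain ⟨x, rfl⟩ := (hex y).1 hy
    haveI := ModuleCat.subsingleton_of_isZero h0
    rw [Subsingleton.elim x 0, map_zero]
  -- so `H₂(W)` embeds into `C₂ ≅ ℤ`: finitely generated, torsion-free, free of rank `≤ 1`
  let bC := Module.finBasisOfFinrankEq ℤ (c.morseHomology g 2 2) hC₂
  set L : singularHomology ℤ ℤ c.W 2 →ₗ[ℤ] (Fin 1 → ℤ) := bC.equivFun.toLinearMap ∘ₗ j ∘ₗ π with hL
  have hinj : Function.Injective L := bC.equivFun.injective.comp (hj.comp hπinj)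
  have htf : Module.IsTorsionFree ℤ (singularHomology ℤ ℤ c.W 2) :=
    Function.Injective.moduleIsTorsionFree (f := ⇑L) hinj fun r m => L.map_smul r m
  haveI hfinW : Module.Finite ℤ (singularHomology ℤ ℤ c.W 2) := Module.Finite.of_injective L hinj
  haveI := htf
  haveI hfreeW : Module.Free ℤ (singularHomology ℤ ℤ c.W 2) := Module.free_of_finite_type_torsion_free'
  refine ⟨hfreeW, hfinW, ?_⟩
  calc Module.finrank ℤ (singularHomology ℤ ℤ c.W 2)
      ≤ Module.finrank ℤ (Fin 1 → ℤ) := LinearMap.finrank_le_finrank_of_injective hinj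
    _ = 1 := by simp

end Morse

/-! ### Complements of saturated submodules -/

section Complement

variable {R : Type*} [CommRing R] [IsDomain R] {F : Type*} [AddCommGroup F] [Module R F]

/-- A saturated submodule (`a • x ∈ L`, `a ≠ 0` forces `x ∈ L`) of a finitely generated module over
a principal ideal domain is complemented: the quotient is torsion-free, hence free, hence
projective, so the quotient map splits. [folklore] -/
theorem exists_isCompl_of_smul_mem [IsPrincipalIdealRing R] [Module.Finite R F] (L : Submodule R F)
    (h : ∀ (a : R) (x : F), a ≠ 0 → a • x ∈ L → x ∈ L) : ∃ L' : Submodule R F, IsCompl L L' := by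
  haveI : Module.IsTorsionFree R (F ⧸ L) := by
    rw [Submodule.isTorsionFree_iff_torsion_eq_bot, eq_bot_iff]
    intro x hx
    obtain ⟨a, ha⟩ := (Submodule.mem_torsion_iff x).1 hx
    obtain ⟨y, rfl⟩ := L.mkQ_surjective x
    rw [Submodule.mem_bot, Submodule.mkQ_apply, Submodule.Quotient.mk_eq_zero]
    refine h a y (nonZeroDivisors.coe_ne_zero a) ?_
    rw [← Submodule.Quotient.mk_eq_zero L, Submodule.Quotient.mk_smul]
    exact ha
  haveI : Module.Free R (F ⧸ L) := Module.free_of_finite_type_torsion_free'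
  obtain ⟨σ, hσ⟩ := Module.projective_lifting_property L.mkQ LinearMap.id L.mkQ_surjective
  have hsec : ∀ q, L.mkQ (σ q) = q := fun q => LinearMap.congr_fun hσ q
  have hπ : ∀ x, ((LinearMap.id : F →ₗ[R] F) - σ.comp L.mkQ) x ∈ L := fun x => by
    apply (Submodule.Quotient.mk_eq_zero L).1
    rw [← Submodule.mkQ_apply L, LinearMap.sub_apply, map_sub, LinearMap.comp_apply, hsec,
      LinearMap.id_apply, sub_self]
  refine ⟨LinearMap.ker (LinearMap.codRestrict L ((LinearMap.id : F →ₗ[R] F) - σ.comp L.mkQ) hπ),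
    LinearMap.isCompl_of_proj fun x => ?_⟩
  apply Subtype.ext
  rw [LinearMap.codRestrict_apply, LinearMap.sub_apply, LinearMap.comp_apply, Submodule.mkQ_apply,
    (Submodule.Quotient.mk_eq_zero L).2 x.2, map_zero, LinearMap.id_apply, sub_zero]

end Complement

/-! ### The twisted surgery of `𝕊⁴` and its trace -/

section Twisted

/-- `𝕊⁴` is simply connected (local instance). [folklore] -/
theorem sphereFour_simplyConnectedSpace : SimplyConnectedSpace (𝕊 4) :=
  simplyConnectedSpace_euclideanSphere (n := 4) (by norm_num)

attribute [local instance] sphereFour_simplyConnectedSpace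

variable (C : StdChart (𝕊 4))

/-- **The twisted tube**: the standard framed circle of the chart `C` of `𝕊⁴` reframed by the
generator `twist` of `π₁ SO(3)` (Kirby 1989, Ch. VIII p. 50: "according to the framing,
`π₁(SO(3)) = ℤ/2`"). [cite: Kirby1989, Ch. VIII p. 50] -/
abbrev twistTube : CircleNbhd (𝓡 4) C.c := C.nbhd.linTwist OpLoop.twist

/-- **The twisted surgery `S² ×~ S²` of `𝕊⁴`**, as the top end of the trace along the twisted tube.
[cite: Kirby1989, Ch. VIII p. 50] -/
abbrev TwistTop : Type := (twistTube C).Top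

/-- **The trace of the twisted surgery**, a cobordism from `𝕊⁴` to `S² ×~ S²` (`𝔻⁵ ∪` one twisted
2-handle, without the ball). [cite: MilnorHCobordism1965, Thm. 3.12] [cite: Kirby1989, Ch. VIII p. 50] -/
abbrev twistTrace : Cobordism (3 + 1) (𝕊 4) (TwistTop C) := (twistTube C).trace

/-- The twisted surgery of `𝕊⁴` is simply connected (a theorem, not an instance: the type is an
`abbrev` over a deep term, and a global instance would be tried — expensively — for every other
`SimplyConnectedSpace` goal). [cite: Kirby1989, Ch. X p. 56] -/
theorem simplyConnectedSpace_twistTop : SimplyConnectedSpace (TwistTop C) :=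
  (twistTube C).simplyConnectedSpace_top

/-- The trace of the twisted surgery is simply connected. [cite: Kirby1989, Ch. X p. 56] -/
theorem simplyConnectedSpace_twistTrace : SimplyConnectedSpace (twistTrace C).W :=
  (twistTube C).simplyConnectedSpace_trace

/-- **The twisted surgery of `𝕊⁴` has an ODD intersection form, for every orientation**
(`S² ×~ S² ≅ ℂℙ² # -ℂℙ²`; the tree's `isOdd_intersectionForm_of_isOpenGluingWith_twist`).
[cite: Kirby1989, Ch. VIII p. 50 and Ch. I §3 p. 10] [cite: GompfStipsicz1999, §5.2 and §1.2] -/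
theorem isOdd_intersectionForm_twistTop (μ : HomologicalOrientation ℤ (TwistTop C) 4) :
    (Q⟦μ⟧).IsOdd :=
  isOdd_intersectionForm_of_isOpenGluingWith_twist C (twistTube C).isOpenGluingWith_top μ

/-- **`H₂` of the trace of the twisted surgery is free of rank `≤ 1`** (an elementary cobordism of
index `2` over `𝕊⁴`, `H₂(𝕊⁴) = 0`). [cite: MilnorHCobordism1965, Thm. 7.4, Cor. 3.15] -/
theorem free_singularHomology_two_twistTrace :
    Module.Free ℤ (singularHomology ℤ ℤ (twistTrace C).W 2) ∧
      Module.Finite ℤ (singularHomology ℤ ℤ (twistTrace C).W 2) ∧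
      Module.finrank ℤ (singularHomology ℤ ℤ (twistTrace C).W 2) ≤ 1 := by
  refine (twistTube C).isElementary_trace.free_singularHomology_two_of_isZero ?_
  -- `range inl ≃ 𝕊⁴` has `H₂ = 0`
  have e : (𝕊 4) ≃ₜ range (twistTrace C).inl :=
    (twistTrace C).isSmoothEmbedding_inl.isEmbedding.toHomeomorph
  exact (isZero_singularHomology_sphere_holds ℤ ℤ (n := 4) (k := 2) (by omega) (by omega)).of_iso
    (singularHomology.mapIso ℤ ℤ e.symm 2)

end Twisted


/-! ### Wall's normal form for an arbitrary `Module ℤ` instance -/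

/-- **Wall's normal form of a Lagrangian direct summand** (`Lagrangian.exists_normalForm`, stated for
the canonical `ℤ`-module structure) for an arbitrary `Module ℤ` instance, such as the one carried by
`H²(M; ℤ)/T` (all such instances coincide). [cite: WallJLMS1964, §2, p. 145] -/
theorem Lagrangian.exists_normalForm_of_module {V : Type*} [AddCommGroup V] [inst : Module ℤ V]
    [Module.Free ℤ V] [Module.Finite ℤ V] {Q : BilinForm ℤ V} (hQ : Q.IsSymm) (hU : Q.IsUnimodular)
    {L L' : Submodule ℤ V} (hc : IsCompl L L') (hLi : ∀ x ∈ L, ∀ y ∈ L, Q x y = 0)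
    (hr : 2 * finrank ℤ L = finrank ℤ V) :
    ∃ (b : Basis (Fin (finrank ℤ L) ⊕ Fin (finrank ℤ L)) ℤ V) (o : Option (Fin (finrank ℤ L))),
      Submodule.span ℤ (Set.range (b ∘ Sum.inl)) = L ∧
      (∀ i j, Q (b (Sum.inl i)) (b (Sum.inr j)) = if i = j then 1 else 0) ∧
      (o = none ↔ Q.IsEven) ∧
      ∀ i j, Q (b (Sum.inr i)) (b (Sum.inr j)) = if i = j ∧ o = some i then 1 else 0 := by
  obtain rfl : inst = AddCommGroup.toIntModule V := Subsingleton.elim _ _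
  obtain ⟨b, o, hb, ho, hG⟩ := Lagrangian.exists_normalForm hQ hU hc hLi hr
  exact ⟨b, o, hb.span_eq, hb.dual, ho, hG⟩

/-! ### The lattice of the top of an elementary index-2 cobordism with `H₂ ≤ ℤ`, and its dying classes -/

section Lattice

variable {S T : Type} [TopologicalSpace S] [T2Space S] [SecondCountableTopology S]
  [ChartedSpace (𝔼 4) S] [IsManifold (𝓡 4) ∞ S] [CompactSpace S] [SimplyConnectedSpace S]
  [TopologicalSpace T] [T2Space T] [SecondCountableTopology T]
  [ChartedSpace (𝔼 4) T] [IsManifold (𝓡 4) ∞ T] [CompactSpace T] [SimplyConnectedSpace T]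

/-- **The lattice of the top end and the classes dying in the cobordism** (module docstring,
(i)–(iv)), for a simply connected cobordism `E` from a simply connected closed `S` with
`H²(S)/T = 0` to a simply connected closed `T`, with `H₂(T) → H₂(E)` onto and `H₂(E)` free of rank
`≤ 1`: for every orientation `μ` of `T` with `Q⟦μ⟧` odd there is a basis `(bT 0, bT 1)` of
`H²(T)/T` with Gram matrix `!![0, 1; 1, 1]` such that every `y ∈ H₂(T)` with `⟨bT 0, y⟩ = 0` dies
in `E` (`inr_* y = 0`).  Ingredients: Kronecker biduality
(`mem_range_iff_forall_mem_ker_pairing_eq_zero`, `mem_ker_of_forall_pairing_eq_zero`), Thom's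
isotropy and half-rank theorems for `E` (`Cobordism.intersectionForm_eq_of_mem_boundaryImage`,
`two_mul_boundaryImageRank_eq_holds`), oddness (`b₂ ≥ 1`), and Wall's normal form of a Lagrangian
(`Lagrangian.exists_normalForm`).  Stated for an abstract cobordism (the twisted trace is plugged
in below). [cite: WallJLMS1964, §2 p. 145] [cite: Thom1952, Thm V.7, Cor. V.8 (p. 173)]
[cite: Kirby1989, Ch. VIII p. 50] -/
theorem exists_basis_of_trace (E : Cobordism 4 S T) [SimplyConnectedSpace E.W]
    (hS : ∀ a : freeCohomology ℤ S 2, a = 0)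
    (hepi : Epi (singularHomology.map ℤ ℤ (⟨E.inr, E.continuous_inr⟩ : C(T, E.W)) 2))
    [Module.Free ℤ (singularHomology ℤ ℤ E.W 2)] [Module.Finite ℤ (singularHomology ℤ ℤ E.W 2)]
    (hrankE : Module.finrank ℤ (singularHomology ℤ ℤ E.W 2) ≤ 1)
    (μ : HomologicalOrientation ℤ T 4) (hodd : (Q⟦μ⟧).IsOdd) :
    ∃ bT : Basis (Fin 2) ℤ (freeCohomology ℤ T 2),
      Q⟦μ⟧ (bT 0) (bT 0) = 0 ∧ Q⟦μ⟧ (bT 0) (bT 1) = 1 ∧ Q⟦μ⟧ (bT 1) (bT 1) = 1 ∧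
      ∀ y : singularHomology ℤ ℤ T 2, freeKroneckerPairing T 2 (bT 0) y = 0 →
        singularHomology.map ℤ ℤ (⟨E.inr, E.continuous_inr⟩ : C(T, E.W)) 2 y = 0 := by
  classical
  -- the lattices
  obtain ⟨hfinT, hfreeT⟩ := finite_and_free_freeCohomology_two (M := T)
  haveI := hfinT
  haveI := hfreeT
  have hsymm : (Q⟦μ⟧).IsSymm :=
    isSymm_intersectionForm (cupProduct_gradedComm_holds ℤ T) even_two two_add_two_eq_four μ
  have hU : (Q⟦μ⟧).IsUnimodular := isPerfPair_intersectionForm_four_of_compactSpace (M := T) μ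
  -- Kronecker maps and the maps of the cobordism
  let κT := freeKroneckerPairing T 2
  let κE := freeKroneckerPairing E.W 2
  have hκTb : Function.Bijective κT := freeKroneckerPairing_two_bijective (X := T)
  have hκEb : Function.Bijective κE := freeKroneckerPairing_two_bijective (X := E.W)
  let inrC : C(T, E.W) := ⟨E.inr, E.continuous_inr⟩
  obtain ⟨ih, hih⟩ : ∃ ih : singularHomology ℤ ℤ T 2 →ₗ[ℤ] singularHomology ℤ ℤ E.W 2,
      ∀ y, ih y = singularHomology.map ℤ ℤ inrC 2 y := ⟨(singularHomology.map ℤ ℤ inrC 2).hom, fun y => rfl⟩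
  have hihs : Function.Surjective ih := by
    intro w
    obtain ⟨y, hy⟩ := (ModuleCat.epi_iff_surjective _).1 hepi w
    exact ⟨y, (hih y).trans hy⟩
  obtain ⟨ic, hic⟩ : ∃ ic : freeCohomology ℤ E.W 2 →ₗ[ℤ] freeCohomology ℤ T 2,
      ic = freeCohomology.map (R := ℤ) inrC 2 := ⟨_, rfl⟩
  have hadj : ∀ b x, κT (ic b) x = κE b (ih x) := fun b x => by
    rw [hic, hih]; exact freeKroneckerPairing_map inrC b x
  -- `A = im ic` is the annihilator of the dying classes `ker ih`
  obtain ⟨A, hA⟩ : ∃ A : Submodule ℤ (freeCohomology ℤ T 2), A = LinearMap.range ic := ⟨_, rfl⟩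
  have hAiff : ∀ a, a ∈ A ↔ ∀ x ∈ LinearMap.ker ih, κT a x = 0 := fun a => by
    rw [hA]; exact mem_range_iff_forall_mem_ker_pairing_eq_zero κT κE hihs hadj hκTb.1 hκEb.2 a
  have hdie : ∀ y, (∀ a ∈ A, κT a y = 0) → ih y = 0 := fun y hy =>
    LinearMap.mem_ker.1 (mem_ker_of_forall_pairing_eq_zero κT hκTb.2 ih fun a ha => hy a ((hAiff a).2 ha))
  -- `rank A ≤ rank H²(E)/T = rank H₂(E) ≤ 1`
  have hAle : Module.finrank ℤ A ≤ 1 := by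
    let e₁ := LinearEquiv.ofBijective κE hκEb
    haveI : Module.Finite ℤ (freeCohomology ℤ E.W 2) := Module.Finite.equiv e₁.symm
    let bE := Module.Free.chooseBasis ℤ (singularHomology ℤ ℤ E.W 2)
    haveI : Fintype (Module.Free.ChooseBasisIndex ℤ (singularHomology ℤ ℤ E.W 2)) :=
      Module.Free.ChooseBasisIndex.fintype ℤ _
    have hdual : Module.finrank ℤ (Module.Dual ℤ (singularHomology ℤ ℤ E.W 2)) =
        Module.finrank ℤ (singularHomology ℤ ℤ E.W 2) := by
      rw [Module.finrank_eq_card_basis bE.dualBasis, Module.finrank_eq_card_basis bE]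
    have h1 : Module.finrank ℤ (freeCohomology ℤ E.W 2) ≤ 1 := by
      rw [e₁.finrank_eq, hdual]; exact hrankE
    have h2 : Module.finrank ℤ A ≤ Module.finrank ℤ (freeCohomology ℤ E.W 2) := by
      rw [hA]
      convert LinearMap.finrank_range_le ic using 2
      exact Subsingleton.elim _ _
    exact h2.trans h1
  -- Thom: a relative fundamental class of the (simply connected) cobordism and compatible orientations
  obtain ⟨z, hz⟩ := Cobordism.exists_isRelFundamentalClass_of_simplyConnectedSpace E
  obtain ⟨μS₀⟩ := isOrientableOver_of_simplyConnectedSpace ℤ S (n := 4)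
  obtain ⟨μS, νT, -, hνT, hw⟩ := Cobordism.exists_orientations_δ_eq (by norm_num) E μS₀ μ hz
  have hrank := two_mul_boundaryImageRank_eq_holds μS νT E z hw
  -- `H²(S)/T = 0`
  have hS0 : Module.finrank ℤ (freeCohomology ℤ S 2) = 0 := by
    haveI : Subsingleton (freeCohomology ℤ S 2) := ⟨fun a b => (hS a).trans (hS b).symm⟩
    exact Module.finrank_zero_of_subsingleton
  rw [hS0, zero_add] at hrank
  -- the boundary image projects isomorphically onto `A`
  obtain ⟨B, hB⟩ : ∃ B : Submodule ℤ (freeCohomologyPair ℤ S T 2), B = E.boundaryImage ℤ 2 := ⟨_, rfl⟩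
  let sndP := freeCohomologyPair.snd ℤ S T 2
  have hcomp : sndP ∘ₗ E.boundaryRestrict ℤ 2 =
      ic ∘ₗ (freeCohomology.mk (R := ℤ) (X := E.W) (k := 2)) :=
    LinearMap.ext fun a => by
      rw [LinearMap.comp_apply, LinearMap.comp_apply, Cobordism.snd_boundaryRestrict, hic,
        freeCohomology.map_mk]
  have hsndB : B.map sndP = A := by
    rw [hB, hA, Cobordism.boundaryImage, ← LinearMap.range_comp, hcomp, LinearMap.range_comp_of_range_eq_top]
    exact LinearMap.range_eq_top.2 freeCohomology.mk_surjective
  -- `H²(S)/T = 0`: the second projection is a linear isomorphism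
  have hsnd_bij : Function.Bijective sndP :=
    ⟨fun x y hxy => Prod.ext ((hS _).trans (hS _).symm) hxy, fun t => ⟨(0, t), rfl⟩⟩
  have hcoe : ((LinearEquiv.ofBijective sndP hsnd_bij : _ ≃ₗ[ℤ] _) : _ →ₗ[ℤ] _) = sndP :=
    LinearMap.ext fun x => rfl
  have hfinA : Module.finrank ℤ A = E.boundaryImageRank ℤ 2 := by
    have e := LinearEquiv.finrank_map_eq (LinearEquiv.ofBijective sndP hsnd_bij) B
    rw [hcoe, hsndB] at e
    rw [Cobordism.boundaryImageRank, ← hB]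
    convert e using 2 <;> first | rfl | exact Subsingleton.elim _ _
  have hrankA : 2 * Module.finrank ℤ A = Module.finrank ℤ (freeCohomology ℤ T 2) := by
    rw [hfinA]; exact hrank
  -- `b₂(T) ≥ 1` (odd form), so `rank A = 1`, `b₂(T) = 2`
  have hpos : 0 < Module.finrank ℤ (freeCohomology ℤ T 2) := by
    rw [Module.finrank_pos_iff_exists_ne_zero]
    have hodd' := hodd
    simp only [LinearMap.BilinForm.IsOdd, LinearMap.BilinForm.IsEven, not_forall] at hodd'
    obtain ⟨v, hv⟩ := hodd'
    refine ⟨v, fun h0 => hv ?_⟩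
    rw [h0]
    exact ⟨0, by simp⟩
  have hk : Module.finrank ℤ A = 1 := by omega
  -- `A` is isotropic (Thom) for `Q⟦μ⟧`
  have hAi : ∀ a₁ ∈ A, ∀ a₂ ∈ A, Q⟦μ⟧ a₁ a₂ = 0 := by
    intro a₁ ha₁ a₂ ha₂
    rw [← hsndB] at ha₁ ha₂
    obtain ⟨x₁, hx₁, rfl⟩ := ha₁
    obtain ⟨x₂, hx₂, rfl⟩ := ha₂
    rw [hB] at hx₁ hx₂
    have hT := E.intersectionForm_eq_of_mem_boundaryImage two_add_two_eq_four μS νT z hw hx₁ hx₂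
    rw [hS (freeCohomologyPair.fst ℤ S T 2 x₁), map_zero, LinearMap.zero_apply] at hT
    have hν : Q⟦νT⟧ (sndP x₁) (sndP x₂) = 0 := hT.symm
    rcases hνT with rfl | rfl
    · exact hν
    · rw [intersectionForm_neg (HomologicalOrientation.fundamentalClass_neg_holds ℤ T 4) two_add_two_eq_four μ,
        LinearMap.neg_apply, LinearMap.neg_apply, neg_eq_zero] at hν
      exact hν
  -- `A` is saturated, hence complemented
  obtain ⟨A', hc⟩ : ∃ A', IsCompl A A' := by
    refine exists_isCompl_of_smul_mem A ?_
    intro m a hm hma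
    rw [hAiff] at hma ⊢
    intro x hx
    have h := hma x hx
    rw [LinearMap.map_smul, LinearMap.smul_apply, smul_eq_mul] at h
    exact (mul_eq_zero.1 h).resolve_left hm
  -- Wall's normal form of the Lagrangian `A` in the odd lattice `H²(T)/T`
  obtain ⟨b, o, hbspan, hbdual, ho, hG⟩ := Lagrangian.exists_normalForm_of_module hsymm hU hc hAi hrankA
  have hsub : ∀ i j : Fin (Module.finrank ℤ A), i = j := fun i j => by
    apply Fin.ext; have := i.isLt; have := j.isLt; omega
  set i₀ : Fin (Module.finrank ℤ A) := ⟨0, by omega⟩ with hi₀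
  have hosome : o = some i₀ := by
    cases ho' : o with
    | none => exact absurd ((ho.1 ho')) hodd
    | some j => rw [hsub j i₀]
  set e := b (Sum.inl i₀) with he
  set f := b (Sum.inr i₀) with hf
  have hef : Q⟦μ⟧ e f = 1 := by rw [he, hf, hbdual, if_pos rfl]
  have heA : e ∈ A := by rw [← hbspan]; exact Submodule.subset_span ⟨i₀, rfl⟩
  have hee : Q⟦μ⟧ e e = 0 := hAi e heA e heA
  have hff : Q⟦μ⟧ f f = 1 := by rw [hf, hG, if_pos ⟨rfl, hosome⟩]
  -- `A = ℤ e`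
  have hAe : ∀ a ∈ A, a ∈ Submodule.span ℤ {e} := by
    intro a ha
    rw [← hbspan] at ha
    have hle : Submodule.span ℤ (Set.range (b ∘ Sum.inl)) ≤ Submodule.span ℤ {e} := by
      refine Submodule.span_mono ?_
      rintro _ ⟨i, rfl⟩
      rw [Set.mem_singleton_iff, Function.comp_apply, hsub i i₀]
    exact hle ha
  -- the basis `(e, f)` indexed by `Fin 2`
  let ε : Fin (Module.finrank ℤ A) ⊕ Fin (Module.finrank ℤ A) ≃ Fin 2 :=
    (Equiv.sumCongr (finCongr hk) (finCongr hk)).trans finSumFinEquiv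
  have hε0 : ε.symm 0 = Sum.inl i₀ := by
    apply ε.injective; rw [Equiv.apply_symm_apply]
    simp [ε, finSumFinEquiv, Fin.ext_iff]
  have hε1 : ε.symm 1 = Sum.inr i₀ := by
    apply ε.injective; rw [Equiv.apply_symm_apply]
    simp [ε, finSumFinEquiv, Fin.ext_iff]
  refine ⟨b.reindex ε, ?_, ?_, ?_, fun y hy => ?_⟩
  · rw [Basis.reindex_apply, hε0, ← he, hee]
  · rw [Basis.reindex_apply, Basis.reindex_apply, hε0, hε1, ← he, ← hf, hef]
  · rw [Basis.reindex_apply, hε1, ← hf, hff]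
  · rw [Basis.reindex_apply, hε0, ← he] at hy
    rw [← hih]
    refine hdie y fun a ha => ?_
    obtain ⟨t, rfl⟩ := Submodule.mem_span_singleton.1 (hAe a ha)
    rw [LinearMap.map_smul, LinearMap.smul_apply, hy, smul_zero]

end Lattice

/-! ### Fillings `V = 𝔻⁵ ∪_{𝕊⁴} E` of the top end of a cobordism from `𝕊⁴` -/

section Filling

attribute [local instance] sphereFour_simplyConnectedSpace

variable {T : Type} [TopologicalSpace T] [T2Space T] [SecondCountableTopology T]
  [ChartedSpace (𝔼 4) T] [IsManifold (𝓡 4) ∞ T] [CompactSpace T] [SimplyConnectedSpace T]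

set_option maxHeartbeats 800000 in
/-- **Capping a cobordism from `𝕊⁴` by the ball**: for a simply connected cobordism `E` from `𝕊⁴`
to a simply connected closed `T` with `H₂(T) → H₂(E)` onto, the attachment `V = 𝔻⁵ ∪_{𝕊⁴} E`
(`NullCobordism.closedBall 4`, `exists_cobordismAttachment_holds`, Milnor 1965 Thm. 1.4) is a
compact simply connected smooth `5`-manifold with boundary datum `bV`, `bV.carrier = T`, with
`H₂(T) → H₂(V)` onto (Mayer–Vietoris: `CobordismAttachment.epi_map_jX_of_epi`, `H₁(𝕊⁴) = 0`,
`H₂(𝔻⁵) = 0`); every per-orientation basis statement with a dying law in `E` descends to `V`.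
[cite: MilnorHCobordism1965, §1 Thm. 1.4] [cite: Kirby1989, Ch. X pp. 55–56] -/
theorem exists_filling_of_cobordism_sphereFour (E : Cobordism 4 (𝕊 4) T) [SimplyConnectedSpace E.W]
    (hepi : Epi (singularHomology.map ℤ ℤ (⟨E.inr, E.continuous_inr⟩ : C(T, E.W)) 2))
    (hbasis : ∀ μ : HomologicalOrientation ℤ T 4,
      ∃ bT : Basis (Fin 2) ℤ (freeCohomology ℤ T 2),
        Q⟦μ⟧ (bT 0) (bT 0) = 0 ∧ Q⟦μ⟧ (bT 0) (bT 1) = 1 ∧ Q⟦μ⟧ (bT 1) (bT 1) = 1 ∧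
        ∀ y : singularHomology ℤ ℤ T 2, freeKroneckerPairing T 2 (bT 0) y = 0 →
          singularHomology.map ℤ ℤ (⟨E.inr, E.continuous_inr⟩ : C(T, E.W)) 2 y = 0) :
    ∃ (W : Type) (_ : TopologicalSpace W) (_ : T2Space W) (_ : SecondCountableTopology W)
      (_ : ChartedSpace (EuclideanHalfSpace (4 + 1)) W) (_ : IsManifold (𝓡∂ (4 + 1)) ∞ W)
      (_ : CompactSpace W) (_ : SimplyConnectedSpace W)
      (bW : BoundaryData (𝓡∂ (4 + 1)) W (𝓡 4)) (_ : T2Space bW.carrier)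
      (_ : SecondCountableTopology bW.carrier) (_ : CompactSpace bW.carrier)
      (_ : SimplyConnectedSpace bW.carrier),
      (∀ μ : HomologicalOrientation ℤ bW.carrier 4,
        ∃ bT : Basis (Fin 2) ℤ (freeCohomology ℤ bW.carrier 2),
          Q⟦μ⟧ (bT 0) (bT 0) = 0 ∧ Q⟦μ⟧ (bT 0) (bT 1) = 1 ∧ Q⟦μ⟧ (bT 1) (bT 1) = 1 ∧
          ∀ y : singularHomology ℤ ℤ bW.carrier 2, freeKroneckerPairing bW.carrier 2 (bT 0) y = 0 →
            singularHomology.map ℤ ℤ bW.inclC 2 y = 0) ∧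
      Epi (singularHomology.map ℤ ℤ bW.inclC 2) := by
  -- attach the cobordism to the closed ball
  let c₀ : NullCobordism 4 (𝕊 4) := NullCobordism.closedBall 4
  obtain ⟨V, i1, i2, i3, i4, i5, ⟨At⟩⟩ := exists_cobordismAttachment_holds 3 c₀.W c₀.boundaryData
    (𝕊 4) T E (Diffeomorph.refl (𝓡 4) (𝕊 4) ∞)
  haveI : CompactSpace V := At.compactSpace
  haveI : ContractibleSpace c₀.W := contractibleSpace_closedBall 5
  haveI : SimplyConnectedSpace V := At.simplyConnectedSpace
  -- `H₂(𝕊⁴) → H₂(𝔻⁵)` is onto (the target vanishes), so `jX_* : H₂(E) → H₂(V)` is onto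
  have hD : IsZero (singularHomology ℤ ℤ c₀.W 2) :=
    isZero_singularHomology_of_contractibleSpace ℤ ℤ two_ne_zero
  haveI : Epi (singularHomology.map ℤ ℤ c₀.boundaryData.inclC (1 + 1)) :=
    ⟨fun g h _ => hD.eq_of_src g h⟩
  have h1S : IsZero (singularHomology ℤ ℤ (𝕊 4) 1) :=
    isZero_singularHomology_one_of_simplyConnectedSpace ℤ ℤ
  have hepiJ : Epi (singularHomology.map ℤ ℤ At.jXC (1 + 1)) := At.epi_map_jX_of_epi ℤ ℤ h1S
  let bW : BoundaryData (𝓡∂ (4 + 1)) V (𝓡 4) :=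
    { carrier := T
      incl := At.jX ∘ E.inr
      isSmoothEmbedding := At.isSmoothEmbedding_jX_comp_inr
      range_incl := At.range_jX_comp_inr }
  have hfac : bW.inclC = At.jXC.comp ⟨E.inr, E.continuous_inr⟩ := rfl
  refine ⟨V, i1, i2, i3, i4, i5, ‹_›, ‹_›, bW, inferInstance, inferInstance, inferInstance,
    inferInstance, fun μ => ?_, ?_⟩
  · obtain ⟨bT, h00, h01, h11, hdie⟩ := hbasis μ
    refine ⟨bT, h00, h01, h11, fun y hy => ?_⟩
    rw [hfac, singularHomology.map_comp, ModuleCat.comp_apply, hdie y hy, map_zero]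
  · rw [hfac, singularHomology.map_comp]
    haveI := hepi
    haveI := hepiJ
    apply epi_comp

/-- **The twisted filling** (module docstring): a compact simply connected smooth `V⁵` with
boundary datum `bV`, whose boundary `T = bV.carrier` (the twisted surgery `S² ×~ S²` of `𝕊⁴`) is
a simply connected closed 4-manifold such that, for EVERY orientation `μ` of `T`, `H²(T)/T` has a
basis `(bT 0, bT 1)` with Gram matrix `!![0, 1; 1, 1]` and every `y ∈ H₂(T)` with `⟨bT 0, y⟩ = 0`
dies in `V`; and `H₂(T) → H₂(V)` is onto: the trace of the twisted surgery (`twistTrace`, simply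
connected, elementary of index `2`, `H₂(𝕊⁴) = 0`, top end odd) capped by `𝔻⁵`
(`exists_filling_of_cobordism_sphereFour`, `exists_basis_of_trace`).
[cite: WallJLMS1964, §2 pp. 144–146] [cite: Kirby1989, Ch. VIII p. 50, Ch. X pp. 55–56]
[cite: MilnorHCobordism1965, §1 Thm. 1.4, Thm. 3.12, Thm. 7.4] -/
theorem exists_twistedFilling :
    ∃ (W : Type) (_ : TopologicalSpace W) (_ : T2Space W) (_ : SecondCountableTopology W)
      (_ : ChartedSpace (EuclideanHalfSpace (4 + 1)) W) (_ : IsManifold (𝓡∂ (4 + 1)) ∞ W)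
      (_ : CompactSpace W) (_ : SimplyConnectedSpace W)
      (bW : BoundaryData (𝓡∂ (4 + 1)) W (𝓡 4)) (_ : T2Space bW.carrier)
      (_ : SecondCountableTopology bW.carrier) (_ : CompactSpace bW.carrier)
      (_ : SimplyConnectedSpace bW.carrier),
      (∀ μ : HomologicalOrientation ℤ bW.carrier 4,
        ∃ bT : Basis (Fin 2) ℤ (freeCohomology ℤ bW.carrier 2),
          Q⟦μ⟧ (bT 0) (bT 0) = 0 ∧ Q⟦μ⟧ (bT 0) (bT 1) = 1 ∧ Q⟦μ⟧ (bT 1) (bT 1) = 1 ∧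
          ∀ y : singularHomology ℤ ℤ bW.carrier 2, freeKroneckerPairing bW.carrier 2 (bT 0) y = 0 →
            singularHomology.map ℤ ℤ bW.inclC 2 y = 0) ∧
      Epi (singularHomology.map ℤ ℤ bW.inclC 2) := by
  have hC := StdChart.exists_mem_source (Classical.arbitrary (𝕊 4))
  obtain ⟨C, -, -⟩ := hC
  haveI : SimplyConnectedSpace (TwistTop C) := simplyConnectedSpace_twistTop C
  haveI : SimplyConnectedSpace (twistTrace C).W := simplyConnectedSpace_twistTrace C
  have hfE := free_singularHomology_two_twistTrace C
  haveI := hfE.1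
  haveI := hfE.2.1
  exact exists_filling_of_cobordism_sphereFour (twistTrace C) (twistTube C).epi_map_inr_trace_two
    fun μ => exists_basis_of_trace (twistTrace C) freeCohomology_sphereFour_two_eq_zero
      (twistTube C).epi_map_inr_trace_two hfE.2.2 μ (isOdd_intersectionForm_twistTop C μ)

end Filling

end Literature.Topology.FourManifolds

end
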